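import Mathlib
import HarnessLib
import Summits.HubbardSuperconductivity.HubbardSuperconductivity.Theorems.KLProgrammeKLRegimeEngineTowerLevelAntitone

/-!
# Route `KLProgramme` — crux K3 ENGINE (stmt-HubbardSuperconductivity-20437 `KLRegimeEngineV17F2`), stub (b) v2, THE LEVELS PACKAGE (ℓ), instantiation (I2):
# THE LEVELLED UNITS AND THE DIMENSIONLESS TOWER ARRAYS of the kit `towerBorn_le_law_tracks` (located item «(I2)-KIT-HMU-LEV», UNITS-MAP §(1),
# k3c2-p3 g12's units verdict PASS 16:55Z; cell gate-hubbard-kl, seat p4 g17 — E1's booking by the (R136) substitute precedent, E1 may rename)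

The kit `EngineV8.towerBorn_le_law_tracks` (…EngineTowerBookkeepingTracks) reads born sizes `b t k p` PER TRACK in the track's own units and ONE track-blind measured
array `μ k m`.  Tracks are level counts `F = t + 1` (known legs, the pinned leg of the `L¹–L^∞` norm included), `t : Fin 5` (`F = 1 … 5`; every `F ≥ 5` has the
same units and is folded into `top := 4` by `klTowerMeasLev_anti`).  The unit of track `t` in degree `2p` at family `J` is
`ε^{2p−1}·2^{(3p−5)J}·2^{−e*(F)J}` with the half-integer level gain `e*(F) = min((F−1)/2, 2) = t/2` (LEV-UNITS-NOTE; k3c3-p2/k3c2-p3's kit-units convention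
`u = 8^J`, `Kc = 2^{−5J}`), keyed on INTEGER powers of `√2`:

* `klLevUnit β M t p J := ε^{2p−1}·8^{J·p} / (2^{5J}·(√2)^{t·J})`, `klLevRatio t p := 8^p/(32·(√2)^t)` (one family step), `klLevUnit_succ`, positivity;
* `klTowerBLev … d t k p` — the dimensionless BORN array: block index `k ≥ 1 ↦ Δ_{k−1}` born at `F_{d(k−1)}`
  (`klTowerBornLev … d (k−1) (2p) (t+1) / klLevUnit … t p (d(k−1))`); index `0 ↦ 0` (the UV datum `b t 0` is the caller's VIRTUAL array, E1 blueprint §1 (α));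
* `klTowerMuLevAt … d t k m := 27^{t+1}·klTowerMeasLev … d k (2m) (t+1) / klLevUnit … t m (dk−1)` and the track-blind `klTowerMuLev … d k m := max_t klTowerMuLevAt`
  (`Finset.sup'`), with `klTowerMuLevAt_le_klTowerMuLev`, `exists_klTowerMuLev_eq` (the `∃ t` of the kit's `hμ` is the argmax), nonnegativity.
Definitions + elementary rows only; nothing about the model is asserted; nothing asserts (ℓ), any stub, K3 or superconductivity.
References: BGM 2006 §2.8 (2.83), (2.93)–(2.98), Lemma 2.5 [cite: BenfattoGiulianiMastropietro2006].
-/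

noncomputable section

namespace Summit.HubbardSuperconductivity.HubbardSuperconductivity.Theorems.EngineV8

set_option linter.dupNamespace false -- summit = problem name (single-conjunct summit), D-0017

open Classical
open Real Finset Literature.MathematicalPhysics.QuantumLattice Literature.Probability.LatticeModels GrassmannAlgebra
open Literature.MathematicalPhysics.QuantumLattice.FermiRG
open Summit.HubbardSuperconductivity.HubbardSuperconductivity.Theorems.KLRegimeSplit
open Summit.HubbardSuperconductivity.HubbardSuperconductivity.Theorems.KLProgrammeLegKernels
open Summit.HubbardSuperconductivity.HubbardSuperconductivity.Theorems.DispersionFlow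

/-! ## §1 The levelled units -/

/-- **`klLevRatio t p`** — the one-family-step unit ratio of track `t` in degree `2p`: `8^p / (32·(√2)^t)` (`= 2^{3p−5}·2^{−e*}`, `e* = t/2`). -/
def klLevRatio (t : Fin 5) (p : ℕ) : ℝ := (8 : ℝ) ^ p / (32 * Real.sqrt 2 ^ (t : ℕ))

/-- **`klLevUnit β M t p J`** — the unit of track `t` (`F = t + 1` known legs), degree `2p`, family `J`:
`ε^{2p−1}·8^{J·p} / (2^{5J}·(√2)^{t·J})`, `ε = imagTimeWeight β M`. -/
def klLevUnit (β : ℝ) (M : ℕ) (t : Fin 5) (p J : ℕ) : ℝ :=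
  imagTimeWeight β M ^ (2 * p - 1) * (8 : ℝ) ^ (J * p) / ((2 : ℝ) ^ (5 * J) * Real.sqrt 2 ^ ((t : ℕ) * J))

/-- The unit ratio is positive. -/
theorem klLevRatio_pos (t : Fin 5) (p : ℕ) : 0 < klLevRatio t p := by
  unfold klLevRatio; positivity

/-- The unit is positive (`0 < β`, `M ≠ 0`). -/
theorem klLevUnit_pos {β : ℝ} (hβ : 0 < β) {M : ℕ} [NeZero M] (t : Fin 5) (p J : ℕ) : 0 < klLevUnit β M t p J := by
  have hε : 0 < imagTimeWeight β M := by
    unfold imagTimeWeight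
    have : (0 : ℝ) < M := Nat.cast_pos.2 (Nat.pos_of_ne_zero (NeZero.ne M))
    positivity
  unfold klLevUnit; positivity

/-- **One family step multiplies the unit by the ratio**: `klLevUnit … (J + 1) = klLevUnit … J · klLevRatio t p`. -/
theorem klLevUnit_succ (β : ℝ) (M : ℕ) (t : Fin 5) (p J : ℕ) :
    klLevUnit β M t p (J + 1) = klLevUnit β M t p J * klLevRatio t p := by
  unfold klLevUnit klLevRatio
  have h2 : (2 : ℝ) ^ (5 * (J + 1)) = (2 : ℝ) ^ (5 * J) * 32 := by rw [Nat.mul_succ, pow_add]; norm_num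
  have h8 : (8 : ℝ) ^ ((J + 1) * p) = (8 : ℝ) ^ (J * p) * (8 : ℝ) ^ p := by rw [Nat.succ_mul, pow_add]
  have hs : Real.sqrt 2 ^ ((t : ℕ) * (J + 1)) = Real.sqrt 2 ^ ((t : ℕ) * J) * Real.sqrt 2 ^ (t : ℕ) := by rw [Nat.mul_succ, pow_add]
  rw [h2, h8, hs]
  have hs0 : 0 < Real.sqrt 2 := Real.sqrt_pos.2 (by norm_num)
  field_simp

/-- **`n` family steps**: `klLevUnit … (J + n) = klLevUnit … J · (klLevRatio t p)^n`. -/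
theorem klLevUnit_add (β : ℝ) (M : ℕ) (t : Fin 5) (p J n : ℕ) :
    klLevUnit β M t p (J + n) = klLevUnit β M t p J * klLevRatio t p ^ n := by
  induction n with
  | zero => simp
  | succ n ih => rw [← Nat.add_assoc, klLevUnit_succ, ih, pow_succ, mul_assoc]

/-! ## §2 The dimensionless arrays -/

variable (L M : ℕ) [NeZero L]

/-- **`klTowerBLev L M β U μ K d t k p`** — the dimensionless BORN levelled array of track `t`: for `k ≥ 1` the born size of `Δ_{k−1}` at its family `F_{d(k−1)}` in
degree `2p` at level `F = t + 1`, divided by the track's unit there; `0` at `k = 0` (the kit's UV datum `b t 0` is a separate virtual array). -/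
def klTowerBLev (β U μ : ℝ) (K : TrigPolyC4v) (d : ℕ) (t : Fin 5) (k p : ℕ) : ℝ :=
  if k = 0 then 0 else klTowerBornLev L M β U μ K d (k - 1) (2 * p) ((t : ℕ) + 1) / klLevUnit β M t p (d * (k - 1))

/-- **`klTowerMuLevAt L M β U μ K d t k m`** — the measured size of the input `𝒱_{dk}` of block `k` at `F_{dk−1}`, level `F = t + 1`, degree `2m`, with the kit rows'
weight `27^F`, in the track's unit at family `dk − 1`. -/
def klTowerMuLevAt (β U μ : ℝ) (K : TrigPolyC4v) (d : ℕ) (t : Fin 5) (k m : ℕ) : ℝ :=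
  (27 : ℝ) ^ ((t : ℕ) + 1) * klTowerMeasLev L M β U μ K d k (2 * m) ((t : ℕ) + 1) / klLevUnit β M t m (d * k - 1)

/-- **`klTowerMuLev L M β U μ K d k m`** — the kit's TRACK-BLIND measured array: the maximum over the five tracks of `klTowerMuLevAt`. -/
def klTowerMuLev (β U μ : ℝ) (K : TrigPolyC4v) (d k m : ℕ) : ℝ :=
  (univ : Finset (Fin 5)).sup' univ_nonempty fun t => klTowerMuLevAt L M β U μ K d t k m

variable {L M}

/-- The born array vanishes at block index `0`. -/
theorem klTowerBLev_zero (β U μ : ℝ) (K : TrigPolyC4v) (d : ℕ) (t : Fin 5) (p : ℕ) : klTowerBLev L M β U μ K d t 0 p = 0 := by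
  simp [klTowerBLev]

/-- The born array at block index `k + 1`. -/
theorem klTowerBLev_succ (β U μ : ℝ) (K : TrigPolyC4v) (d : ℕ) (t : Fin 5) (k p : ℕ) :
    klTowerBLev L M β U μ K d t (k + 1) p = klTowerBornLev L M β U μ K d k (2 * p) ((t : ℕ) + 1) / klLevUnit β M t p (d * k) := by
  simp [klTowerBLev]

/-- Nonnegativity of the born array (`0 < β`, `M ≠ 0`). -/
theorem klTowerBLev_nonneg [NeZero M] {β : ℝ} (hβ : 0 < β) (U μ : ℝ) (K : TrigPolyC4v) (d : ℕ) (t : Fin 5) (k p : ℕ) :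
    0 ≤ klTowerBLev L M β U μ K d t k p := by
  unfold klTowerBLev
  split_ifs
  · exact le_rfl
  · exact div_nonneg (klTowerBornLev_nonneg hβ.le U μ K d _ _ _) (klLevUnit_pos hβ t p _).le

/-- Nonnegativity of the per-track measured array. -/
theorem klTowerMuLevAt_nonneg [NeZero M] {β : ℝ} (hβ : 0 < β) (U μ : ℝ) (K : TrigPolyC4v) (d : ℕ) (t : Fin 5) (k m : ℕ) :
    0 ≤ klTowerMuLevAt L M β U μ K d t k m := by
  unfold klTowerMuLevAt
  exact div_nonneg (mul_nonneg (by positivity) (klTowerMeasLev_nonneg hβ.le U μ K d k _ _)) (klLevUnit_pos hβ t m _).le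

/-- Every track's measured array is at most the track-blind one. -/
theorem klTowerMuLevAt_le_klTowerMuLev (β U μ : ℝ) (K : TrigPolyC4v) (d : ℕ) (t : Fin 5) (k m : ℕ) :
    klTowerMuLevAt L M β U μ K d t k m ≤ klTowerMuLev L M β U μ K d k m :=
  le_sup' (fun t' => klTowerMuLevAt L M β U μ K d t' k m) (mem_univ t)

/-- **The track-blind measured array is attained at some track** (the `∃ t` of the kit's `hμ` is this argmax). -/
theorem exists_klTowerMuLev_eq (β U μ : ℝ) (K : TrigPolyC4v) (d k m : ℕ) :
    ∃ t : Fin 5, klTowerMuLev L M β U μ K d k m = klTowerMuLevAt L M β U μ K d t k m := by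
  obtain ⟨t, -, ht⟩ := exists_mem_eq_sup' (univ_nonempty : (univ : Finset (Fin 5)).Nonempty)
    (fun t' => klTowerMuLevAt L M β U μ K d t' k m)
  exact ⟨t, ht⟩

/-- Nonnegativity of the track-blind measured array. -/
theorem klTowerMuLev_nonneg [NeZero M] {β : ℝ} (hβ : 0 < β) (U μ : ℝ) (K : TrigPolyC4v) (d k m : ℕ) :
    0 ≤ klTowerMuLev L M β U μ K d k m :=
  (klTowerMuLevAt_nonneg hβ U μ K d 0 k m).trans (klTowerMuLevAt_le_klTowerMuLev β U μ K d 0 k m)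

/-- **Folding the higher levels into the top track**: for `5 ≤ F ≤ 2m`... every level `F ≥ 5` is dominated by the top track (`t = 4`, `F = 5`), up to the weight
`27^{F−5}`: `27^F·klTowerMeasLev … (2m) F ≤ 27^{F−5}·(27^5·klTowerMeasLev … (2m) 5)` (`klTowerMeasLev_anti`). -/
theorem pow_mul_klTowerMeasLev_le_top [NeZero M] {β : ℝ} (hβ : 0 < β) (U μ : ℝ) (K : TrigPolyC4v) (d k m : ℕ) {F : ℕ} (hF : 5 ≤ F) :
    (27 : ℝ) ^ F * klTowerMeasLev L M β U μ K d k (2 * m) F ≤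
      (27 : ℝ) ^ (F - 5) * ((27 : ℝ) ^ 5 * klTowerMeasLev L M β U μ K d k (2 * m) 5) := by
  have h := klTowerMeasLev_anti (L := L) (M := M) hβ.le U μ K d k (2 * m) hF
  have e : (27 : ℝ) ^ F = (27 : ℝ) ^ (F - 5) * 27 ^ 5 := by rw [← pow_add, Nat.sub_add_cancel hF]
  rw [e, mul_assoc]
  exact mul_le_mul_of_nonneg_left (mul_le_mul_of_nonneg_left h (by positivity)) (by positivity)

end Summit.HubbardSuperconductivity.HubbardSuperconductivity.Theorems.EngineV8

end
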